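import Mathlib
import Summits.Ventures.DiscreteObjects.Mahler.OddCoefficientsResultant
import Summits.Ventures.DiscreteObjects.Mahler.OddCoefficientsAuxiliary
import Summits.Ventures.DiscreteObjects.Mahler.SubLehmerDegree56

/-!
# Borwein–Dobrowolski–Mossinghoff: odd-coefficient polynomials have `M(f)^{4(d+1)} ≥ 5^d` (venture `DiscreteObjects`, target L)

Cell `pub-namedobj`, seat `pub-namedobj-mahler` (gen 8). Framing: lottery ticket; floor = certified
bounds/negative ranges.

**Theorem** ([BDM07] P. Borwein, E. Dobrowolski, M. J. Mossinghoff, *Lehmer's problem for polynomials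
with odd coefficients*, Ann. of Math. 166 (2007), Cor. 3.4 with Thm. 3.3, case `m = 2`).  If
`f ∈ ℤ[X]` has degree `d`, all its coefficients `f_0, …, f_d` are odd, and `f` has no cyclotomic factor,
then
`log M(f) ≥ (log 5 / 4) · (1 - 1/(d+1))`, i.e. `5^d ≤ M(f)^{4(d+1)}`
(`five_pow_le_intMahlerMeasure_pow`; rpow / log forms `rpow_le_intMahlerMeasure_of_odd`,
`log_intMahlerMeasure_ge_of_odd`).

Proof (the paper's, with the auxiliary polynomial `F(y) = (y² + 1)(y² - 1)⁴` of Cor. 3.4): the nine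
resultants `Res(f, X^{2n}+1) · Res(f, X^n - 1)⁴ · Res(f, X^n + 1)⁴` (`n = d + 1`) are nonzero integers each
divisible by `2^d` (`OddCoefficientsResultant`), while over `ℂ` their product is
`|a|^{10n} ∏_α |F(α^n)| ≤ ‖F‖_∞^d M(f)^{10n}` with `‖F‖_∞² = 2¹⁸/5⁵` (`OddCoefficientsAuxiliary`,
maximum modulus in place of the paper's Lemma 3.2); hence `2^{9d} ≤ (2⁹ 5^{-5/2})^d M^{10n}`.

Consequences: `M(f) ≥ 5^{1/8} > 1.2` as soon as `d ≥ 1` (`intMahlerMeasure_pow_eight_ge_five_of_odd`),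
so **no cyclotomic-free — in particular no irreducible — polynomial with all coefficients odd is
sub-Lehmer** (`not_subLehmer_of_odd_coeffs`, `not_subLehmer_of_irreducible_odd`; for the census of cell
`pub-namedobj`: an irreducible sub-Lehmer polynomial has an even coefficient), and the irreducible form
with the hypotheses of the Literature statement (`five_pow_le_mahlerMeasure_pow_of_irreducible_odd`).

**On the Literature named fact** `Literature.NumberTheory.MahlerMeasure.OddCoefficientsMahlerBound`
(typed from [McKee–Smyth, *Around the Unit Circle*, Prop. 11.3]: "`M(P) ≥ 5^{1/4}`" for irreducible
noncyclotomic `P` with odd coefficients): the source it cites, [BDM07, Cor. 3.4], proves the bound with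
the exponent `(1/4)(1 - 1/(d+1))` formalised here, NOT the degree-free `5^{1/4}` (cf. the chapter notes
of Brunault–Zudilin, *Many Variations of Mahler Measures*: `m(P) > c (1 - 1/(d+1))`, `c = (log 5)/4`
[BDM07], later `c = 0.4162…`).  That named fact is therefore NOT discharged here and should be read as
stronger than the published theorem; nothing in the tree depends on it.
-/

namespace Summit.Ventures.DiscreteObjects.Mahler

open Polynomial

/-- Per-root archimedean bound: for `α ∈ ℂ` and `n ∈ ℕ`,
`|α^{2n} + 1| · |α^n - 1|⁴ · |α^n + 1|⁴ = |F(α^n)| ≤ √(2¹⁸/5⁵) · max(1,|α|)^{10 n}`. -/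
theorem bdm_root_bound (α : ℂ) (n : ℕ) :
    ‖α ^ (2 * n) + 1‖ * (‖α ^ n - 1‖ ^ 4 * ‖α ^ n + 1‖ ^ 4) ≤
      Real.sqrt (2 ^ 18 / 5 ^ 5) * max 1 ‖α‖ ^ (10 * n) := by
  have hid : ‖((α ^ n) ^ 2 + 1) * ((α ^ n) ^ 2 - 1) ^ 4‖ =
      ‖α ^ (2 * n) + 1‖ * (‖α ^ n - 1‖ ^ 4 * ‖α ^ n + 1‖ ^ 4) := by
    have h2 : (α ^ n) ^ 2 = α ^ (2 * n) := by rw [← pow_mul, mul_comm]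
    have h3 : (α ^ n) ^ 2 - 1 = (α ^ n - 1) * (α ^ n + 1) := by ring
    rw [h3, h2, norm_mul, norm_pow, norm_mul, mul_pow]
  rw [← hid]
  refine (norm_bdmAux_le (α ^ n)).trans ?_
  have hm : max 1 ‖α ^ n‖ ≤ max 1 ‖α‖ ^ n := by
    rw [norm_pow]
    exact max_le (one_le_pow₀ (le_max_left _ _))
      (pow_le_pow_left₀ (norm_nonneg _) (le_max_right _ _) n)
  have hK : 0 ≤ Real.sqrt (2 ^ 18 / 5 ^ 5) := Real.sqrt_nonneg _
  calc Real.sqrt (2 ^ 18 / 5 ^ 5) * max 1 ‖α ^ n‖ ^ 10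
      ≤ Real.sqrt (2 ^ 18 / 5 ^ 5) * (max 1 ‖α‖ ^ n) ^ 10 :=
        mul_le_mul_of_nonneg_left (pow_le_pow_left₀ (by positivity) hm 10) hK
    _ = Real.sqrt (2 ^ 18 / 5 ^ 5) * max 1 ‖α‖ ^ (10 * n) := by rw [← pow_mul, mul_comm n 10]

/-- Norm form of a resultant inequality: if `2^{deg f} ≤ |Res_{(deg f, N)}(f, G)|` and `G(z) = g(z)` on
`ℂ`, then `2^{deg f} ≤ |a|^N ∏_α |g(α)|` over the complex roots `α` of `f` (`a` = leading coefficient). -/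
theorem two_pow_le_norm_prod {f G : ℤ[X]} {N : ℕ} (hG : G.natDegree ≤ N)
    (h : (2 : ℤ) ^ f.natDegree ≤ |f.resultant G f.natDegree N|) (g : ℂ → ℂ)
    (hg : ∀ z, (G.map (Int.castRingHom ℂ)).eval z = g z) :
    (2 : ℝ) ^ f.natDegree ≤ ‖(f.map (Int.castRingHom ℂ)).leadingCoeff‖ ^ N *
      ((f.map (Int.castRingHom ℂ)).roots.map (fun α => ‖g α‖)).prod := by
  have h1 : (2 : ℝ) ^ f.natDegree ≤ ‖((f.resultant G f.natDegree N : ℤ) : ℂ)‖ := by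
    rw [Complex.norm_intCast]
    exact_mod_cast h
  rw [resultant_intCast_eq hG, norm_mul, norm_pow] at h1
  have hmp := map_multiset_prod (normHom : ℂ →*₀ ℝ)
    (((f.map (Int.castRingHom ℂ)).roots.map (G.map (Int.castRingHom ℂ)).eval))
  rw [Multiset.map_map] at hmp
  simp only [normHom_apply, Function.comp_def] at hmp
  rw [hmp] at h1
  simp only [hg] at h1
  exact h1

/-- **Borwein–Dobrowolski–Mossinghoff [BDM07, Cor. 3.4 / Thm. 3.3, `m = 2`].**  If all coefficients
`f_0, …, f_d` of `f ∈ ℤ[X]` are odd and `f` has no cyclotomic factor, then `5^d ≤ M(f)^{4(d+1)}`, i.e.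
`log M(f) ≥ (log 5/4)(1 - 1/(d+1))`. -/
theorem five_pow_le_intMahlerMeasure_pow {f : ℤ[X]} (hodd : ∀ i ≤ f.natDegree, Odd (f.coeff i))
    (hcf : ∀ m : ℕ, 0 < m → ¬ cyclotomic m ℤ ∣ f) :
    (5 : ℝ) ^ f.natDegree ≤ intMahlerMeasure f ^ (4 * (f.natDegree + 1)) := by
  have hf0 : f ≠ 0 := ne_zero_of_odd_coeffs hodd
  -- the three resultant inequalities, in norm form over `ℂ`
  have h1 := two_pow_le_norm_prod (N := f.natDegree + 1) (by rw [← C_1, natDegree_X_pow_sub_C])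
    (two_pow_le_abs_resultant_X_pow_sub_one hodd
      (resultant_X_pow_sub_one_ne_zero hf0 hcf (Nat.succ_pos _)))
    (fun α : ℂ => α ^ (f.natDegree + 1) - 1) (fun z => by simp)
  have h2 := two_pow_le_norm_prod (N := f.natDegree + 1) (by rw [← C_1, natDegree_X_pow_add_C])
    (two_pow_le_abs_resultant_X_pow_add_one hodd
      (resultant_X_pow_add_one_ne_zero hf0 hcf (Nat.succ_pos _)))
    (fun α : ℂ => α ^ (f.natDegree + 1) + 1) (fun z => by simp)
  have h3 := two_pow_le_norm_prod (N := 2 * (f.natDegree + 1))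
    (by rw [← C_1, natDegree_X_pow_add_C])
    (two_pow_le_abs_resultant_X_pow_two_mul_add_one hodd
      (resultant_X_pow_add_one_ne_zero hf0 hcf (by omega)))
    (fun α : ℂ => α ^ (2 * (f.natDegree + 1)) + 1) (fun z => by simp)
  -- notation
  set d := f.natDegree with hd
  set n := d + 1 with hn
  set A : ℝ := ‖(f.map (Int.castRingHom ℂ)).leadingCoeff‖ with hA
  set R := (f.map (Int.castRingHom ℂ)).roots with hR
  have hinj : Function.Injective (Int.castRingHom ℂ) := (Int.castRingHom ℂ).injective_int
  have hcard : Multiset.card R = d := by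
    have hs := (IsAlgClosed.splits (f.map (Int.castRingHom ℂ))).natDegree_eq_card_roots
    rw [natDegree_map_eq_of_injective hinj] at hs
    rw [hR, ← hs]
  have hM : intMahlerMeasure f = A * (R.map (fun α => max 1 ‖α‖)).prod :=
    mahlerMeasure_eq_leadingCoeff_mul_prod_roots _
  set Pm := (R.map (fun α => max 1 ‖α‖)).prod with hPm
  set K : ℝ := Real.sqrt (2 ^ 18 / 5 ^ 5) with hK
  have hA0 : 0 ≤ A := norm_nonneg _
  have hPm0 : 0 ≤ Pm := Multiset.prod_map_nonneg (fun α _ => by positivity)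
  have hK0 : 0 ≤ K := Real.sqrt_nonneg _
  -- product of the nine inequalities
  have hT : (R.map (fun α : ℂ => ‖α ^ (2 * n) + 1‖ * (‖α ^ n - 1‖ ^ 4 * ‖α ^ n + 1‖ ^ 4))).prod =
      (R.map (fun α : ℂ => ‖α ^ (2 * n) + 1‖)).prod *
        ((R.map (fun α : ℂ => ‖α ^ n - 1‖)).prod ^ 4 * (R.map (fun α : ℂ => ‖α ^ n + 1‖)).prod ^ 4) := by
    rw [Multiset.prod_map_mul, Multiset.prod_map_mul, Multiset.prod_map_pow, Multiset.prod_map_pow]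
  have hTle : (R.map (fun α : ℂ => ‖α ^ (2 * n) + 1‖ * (‖α ^ n - 1‖ ^ 4 * ‖α ^ n + 1‖ ^ 4))).prod ≤
      K ^ d * Pm ^ (10 * n) := by
    calc (R.map (fun α : ℂ => ‖α ^ (2 * n) + 1‖ * (‖α ^ n - 1‖ ^ 4 * ‖α ^ n + 1‖ ^ 4))).prod
        ≤ (R.map (fun α : ℂ => K * max 1 ‖α‖ ^ (10 * n))).prod :=
          Multiset.prod_map_le_prod_map₀ _ _ (fun α _ => by positivity) (fun α _ => bdm_root_bound α n)
      _ = K ^ d * Pm ^ (10 * n) := by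
          rw [Multiset.prod_map_mul, Multiset.prod_map_pow, Multiset.map_const', Multiset.prod_replicate,
            hcard]
  have hX1 := pow_le_pow_left₀ (by positivity) h1 4
  have hX2 := pow_le_pow_left₀ (by positivity) h2 4
  have h0X3 : (0 : ℝ) ≤ A ^ (2 * n) * (R.map (fun α : ℂ => ‖α ^ (2 * n) + 1‖)).prod :=
    le_trans (by positivity) h3
  have h0X1 : (0 : ℝ) ≤ (A ^ n * (R.map (fun α : ℂ => ‖α ^ n - 1‖)).prod) ^ 4 :=
    le_trans (by positivity) hX1
  have E : ((2 : ℝ) ^ d) ^ 9 ≤ K ^ d * (A * Pm) ^ (10 * n) := by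
    calc ((2 : ℝ) ^ d) ^ 9 = 2 ^ d * ((2 ^ d) ^ 4 * (2 ^ d) ^ 4) := by ring
      _ ≤ (A ^ (2 * n) * (R.map (fun α : ℂ => ‖α ^ (2 * n) + 1‖)).prod) *
            ((A ^ n * (R.map (fun α : ℂ => ‖α ^ n - 1‖)).prod) ^ 4 *
              (A ^ n * (R.map (fun α : ℂ => ‖α ^ n + 1‖)).prod) ^ 4) :=
          mul_le_mul h3 (mul_le_mul hX1 hX2 (by positivity) h0X1) (by positivity) h0X3
      _ = A ^ (10 * n) * ((R.map (fun α : ℂ => ‖α ^ (2 * n) + 1‖)).prod *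
            ((R.map (fun α : ℂ => ‖α ^ n - 1‖)).prod ^ 4 *
              (R.map (fun α : ℂ => ‖α ^ n + 1‖)).prod ^ 4)) := by ring
      _ ≤ A ^ (10 * n) * (K ^ d * Pm ^ (10 * n)) := by
          rw [← hT]
          exact mul_le_mul_of_nonneg_left hTle (by positivity)
      _ = K ^ d * (A * Pm) ^ (10 * n) := by ring
  rw [← hM] at E
  -- square and clear the constants: `2^{18 d} ≤ (2^18/5^5)^d M^{20 n}` gives `5^{5d} ≤ M^{20 n}`
  have hM0 : 0 ≤ intMahlerMeasure f := by rw [hM]; positivity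
  have E2 : (((2 : ℝ) ^ d) ^ 9) ^ 2 ≤ (K ^ d * intMahlerMeasure f ^ (10 * n)) ^ 2 :=
    pow_le_pow_left₀ (by positivity) E 2
  have hK2 : K ^ 2 = 2 ^ 18 / 5 ^ 5 := Real.sq_sqrt (by positivity)
  have E3 : ((2 : ℝ) ^ 18) ^ d ≤ ((2 : ℝ) ^ 18 / 5 ^ 5) ^ d * intMahlerMeasure f ^ (20 * n) := by
    have lhs : (((2 : ℝ) ^ d) ^ 9) ^ 2 = ((2 : ℝ) ^ 18) ^ d := by
      rw [← pow_mul, ← pow_mul, ← pow_mul]; ring_nf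
    have rhs : (K ^ d * intMahlerMeasure f ^ (10 * n)) ^ 2 =
        (K ^ 2) ^ d * intMahlerMeasure f ^ (20 * n) := by
      rw [mul_pow, ← pow_mul, ← pow_mul, ← pow_mul]; ring_nf
    rw [lhs, rhs, hK2] at E2
    exact E2
  have E4 : ((5 : ℝ) ^ 5) ^ d ≤ intMahlerMeasure f ^ (20 * n) := by
    rw [div_pow] at E3
    have hpos : (0 : ℝ) < (2 ^ 18) ^ d := by positivity
    have hpos5 : (0 : ℝ) < (5 ^ 5) ^ d := by positivity
    -- `(2^18)^d ≤ (2^18)^d / (5^5)^d * X`  ⇒  `(5^5)^d ≤ X`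
    rw [div_mul_eq_mul_div, le_div_iff₀ hpos5] at E3
    nlinarith [E3, hpos]
  have E5 : ((5 : ℝ) ^ d) ^ 5 ≤ (intMahlerMeasure f ^ (4 * n)) ^ 5 := by
    have l : ((5 : ℝ) ^ d) ^ 5 = ((5 : ℝ) ^ 5) ^ d := by rw [← pow_mul, ← pow_mul, mul_comm]
    have r : (intMahlerMeasure f ^ (4 * n)) ^ 5 = intMahlerMeasure f ^ (20 * n) := by
      rw [← pow_mul, show 4 * n * 5 = 20 * n by ring]
    rw [l, r]
    exact E4
  exact le_of_pow_le_pow_left₀ (by norm_num) (by positivity) E5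

/-- Rpow form: `M(f) ≥ 5^{d/(4(d+1))}`. -/
theorem rpow_le_intMahlerMeasure_of_odd {f : ℤ[X]} (hodd : ∀ i ≤ f.natDegree, Odd (f.coeff i))
    (hcf : ∀ m : ℕ, 0 < m → ¬ cyclotomic m ℤ ∣ f) :
    (5 : ℝ) ^ ((f.natDegree : ℝ) / (4 * (f.natDegree + 1))) ≤ intMahlerMeasure f := by
  have h := five_pow_le_intMahlerMeasure_pow hodd hcf
  have hM0 : 0 ≤ intMahlerMeasure f := by
    unfold intMahlerMeasure; exact Polynomial.mahlerMeasure_nonneg _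
  have hN : (0 : ℝ) < 4 * (f.natDegree + 1) := by positivity
  -- take the `4(d+1)`-th root
  have h' : ((5 : ℝ) ^ ((f.natDegree : ℝ) / (4 * (f.natDegree + 1)))) ^ (4 * (f.natDegree + 1)) ≤
      intMahlerMeasure f ^ (4 * (f.natDegree + 1)) := by
    rw [← Real.rpow_natCast, ← Real.rpow_mul (by norm_num)]
    have : (f.natDegree : ℝ) / (4 * (f.natDegree + 1)) * ((4 * (f.natDegree + 1) : ℕ) : ℝ) =
        (f.natDegree : ℝ) := by
      push_cast
      field_simp
    rw [this, Real.rpow_natCast]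
    exact h
  exact le_of_pow_le_pow_left₀ (by positivity) hM0 h'

/-- Logarithmic form [BDM07, (3.7)]: `log M(f) ≥ (log 5 / 4)(1 - 1/(d+1))`. -/
theorem log_intMahlerMeasure_ge_of_odd {f : ℤ[X]} (hodd : ∀ i ≤ f.natDegree, Odd (f.coeff i))
    (hcf : ∀ m : ℕ, 0 < m → ¬ cyclotomic m ℤ ∣ f) :
    Real.log 5 / 4 * (1 - 1 / (f.natDegree + 1)) ≤ Real.log (intMahlerMeasure f) := by
  have h := rpow_le_intMahlerMeasure_of_odd hodd hcf
  have h5 : (0 : ℝ) < (5 : ℝ) ^ ((f.natDegree : ℝ) / (4 * (f.natDegree + 1))) := by positivity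
  have hlog := Real.log_le_log h5 h
  rw [Real.log_rpow (by norm_num)] at hlog
  have heq : Real.log 5 / 4 * (1 - 1 / (f.natDegree + 1)) =
      (f.natDegree : ℝ) / (4 * (f.natDegree + 1)) * Real.log 5 := by
    have : (f.natDegree : ℝ) + 1 ≠ 0 := by positivity
    field_simp
    ring
  rw [heq]
  exact hlog

/-- For `d ≥ 1`: `M(f)^8 ≥ 5`, i.e. `M(f) ≥ 5^{1/8} = 1.2228…`. -/
theorem intMahlerMeasure_pow_eight_ge_five_of_odd {f : ℤ[X]} (hodd : ∀ i ≤ f.natDegree, Odd (f.coeff i))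
    (hcf : ∀ m : ℕ, 0 < m → ¬ cyclotomic m ℤ ∣ f) (hd : 1 ≤ f.natDegree) :
    (5 : ℝ) ≤ intMahlerMeasure f ^ 8 := by
  have h := five_pow_le_intMahlerMeasure_pow hodd hcf
  have hM0 : 0 ≤ intMahlerMeasure f := by
    unfold intMahlerMeasure; exact Polynomial.mahlerMeasure_nonneg _
  have hM1 : 1 ≤ intMahlerMeasure f := one_le_intMahlerMeasure (ne_zero_of_odd_coeffs hodd)
  -- from `5^d ≤ M^{4(d+1)}`, `4(d+1) ≤ 8d` (as `d ≥ 1`) and `M ≥ 1`: `5^d ≤ M^{8d} = (M^8)^d`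
  have h2 : intMahlerMeasure f ^ (4 * (f.natDegree + 1)) ≤ intMahlerMeasure f ^ (8 * f.natDegree) :=
    pow_le_pow_right₀ hM1 (by omega)
  have h3 : (5 : ℝ) ^ f.natDegree ≤ (intMahlerMeasure f ^ 8) ^ f.natDegree := by
    rw [← pow_mul]; exact h.trans h2
  exact le_of_pow_le_pow_left₀ (by omega) (by positivity) h3

/-- If an irreducible `f ∈ ℤ[X]` has `M(f) > 1` then `f` is cyclotomic-free (an irreducible multiple of
`Φ_m` is `± Φ_m`, of measure `1`). -/
theorem cyclotomicFree_of_irreducible_of_one_lt {f : ℤ[X]} (hirr : Irreducible f)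
    (h1 : 1 < intMahlerMeasure f) : ∀ m : ℕ, 0 < m → ¬ cyclotomic m ℤ ∣ f := by
  intro m hm hdvd
  have hass : Associated (cyclotomic m ℤ) f := (cyclotomic.irreducible hm).associated_of_dvd hirr hdvd
  obtain ⟨u, hu⟩ := hass
  obtain ⟨c, hc, hcu⟩ := Polynomial.isUnit_iff.mp u.isUnit
  have hMu : intMahlerMeasure (↑u : ℤ[X]) = 1 := by
    rw [← hcu]
    unfold intMahlerMeasure
    rw [map_C, mahlerMeasure_const, eq_intCast, Complex.norm_intCast]
    rcases Int.isUnit_iff.mp hc with h | h <;> simp [h]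
  have hM : intMahlerMeasure f = 1 := by
    rw [← hu, intMahlerMeasure_mul, intMahlerMeasure_cyclotomic, hMu, one_mul]
  linarith

/-- **No cyclotomic-free polynomial with all coefficients odd is sub-Lehmer**: for `d ≥ 1`,
`M(f) ≥ 5^{1/8} > 1.2 > M(L) = 1.176…`, and for `d = 0`, `M(f) = |f_0|` is an integer.  Census reading
(cell `pub-namedobj`, target L): a cyclotomic-free sub-Lehmer polynomial has at least one even
coefficient. -/
theorem not_subLehmer_of_odd_coeffs {f : ℤ[X]} (hodd : ∀ i ≤ f.natDegree, Odd (f.coeff i))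
    (hcf : ∀ m : ℕ, 0 < m → ¬ cyclotomic m ℤ ∣ f) : ¬ SubLehmer f := by
  intro hsub
  have hL := lehmer_measure_upper_bound
  rcases Nat.eq_zero_or_pos f.natDegree with hd0 | hdpos
  · -- constant polynomial: `M = |f_0| ≥ 2` once `> 1`
    have hC := eq_C_of_natDegree_eq_zero hd0
    have hM : intMahlerMeasure f = |(f.coeff 0 : ℝ)| := by
      unfold intMahlerMeasure
      rw [hC, map_C, mahlerMeasure_const, eq_intCast, Complex.norm_intCast, coeff_C_zero]
    obtain ⟨h1, h2⟩ := hsub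
    rw [hM] at h1 h2
    have h3 : (2 : ℝ) ≤ |(f.coeff 0 : ℝ)| := by
      have h1' : (1 : ℤ) < |f.coeff 0| := by exact_mod_cast h1
      have : (2 : ℤ) ≤ |f.coeff 0| := h1'
      exact_mod_cast this
    linarith
  · have h5 := intMahlerMeasure_pow_eight_ge_five_of_odd hodd hcf hdpos
    obtain ⟨h1, h2⟩ := hsub
    have hM0 : 0 ≤ intMahlerMeasure f := by
      unfold intMahlerMeasure; exact Polynomial.mahlerMeasure_nonneg _
    have hlt : intMahlerMeasure f < 6 / 5 := by linarith
    have h8 : intMahlerMeasure f ^ 8 < (6 / 5 : ℝ) ^ 8 := pow_lt_pow_left₀ hlt hM0 (by norm_num)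
    norm_num at h8
    linarith

/-- **No irreducible polynomial with all coefficients odd is sub-Lehmer** (unconditional; combine
`cyclotomicFree_of_irreducible_of_one_lt` with `not_subLehmer_of_odd_coeffs`).  In the census language:
every irreducible sub-Lehmer polynomial — in particular every putative polynomial of measure in
`(1, M(L))` of minimal degree — has an even coefficient. -/
theorem not_subLehmer_of_irreducible_odd {f : ℤ[X]} (hirr : Irreducible f)
    (hodd : ∀ i ≤ f.natDegree, Odd (f.coeff i)) : ¬ SubLehmer f := fun hsub =>
  not_subLehmer_of_odd_coeffs hodd (cyclotomicFree_of_irreducible_of_one_lt hirr hsub.1) hsub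

/-- **Irreducible form** (the hypotheses of the Literature statement
`Literature.NumberTheory.MahlerMeasure.OddCoefficientsMahlerBound`, with the exponent actually proved
in [BDM07, Cor. 3.4]): an irreducible `P ∈ ℤ[X]` with `P ∤ X^n - 1` for all `n ≥ 1` and all coefficients
odd satisfies `5^{deg P} ≤ M(P)^{4(deg P + 1)}`. -/
theorem five_pow_le_mahlerMeasure_pow_of_irreducible_odd (P : ℤ[X]) (hirr : Irreducible P)
    (hnc : ∀ n : ℕ, 0 < n → ¬ P ∣ X ^ n - 1) (hodd : ∀ i ≤ P.natDegree, Odd (P.coeff i)) :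
    (5 : ℝ) ^ P.natDegree ≤ (P.map (Int.castRingHom ℂ)).mahlerMeasure ^ (4 * (P.natDegree + 1)) := by
  have hcf : ∀ m : ℕ, 0 < m → ¬ cyclotomic m ℤ ∣ P := by
    intro m hm hdvd
    have hass : Associated (cyclotomic m ℤ) P :=
      (cyclotomic.irreducible hm).associated_of_dvd hirr hdvd
    exact hnc m hm (hass.symm.dvd.trans (cyclotomic.dvd_X_pow_sub_one m ℤ))
  exact five_pow_le_intMahlerMeasure_pow hodd hcf

end Summit.Ventures.DiscreteObjects.Mahler
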